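import Summits.ABC.StewartYu.PadicG3SatNStatic
import Summits.ABC.StewartYu.PadicG3SatNExp
import Summits.ABC.StewartYu.PadicG3ParNBudgetC
import HarnessLib

/-!
# Cell abc-stewartyu, WP-L.P(odd) (crux r3 `PadicCoreOddRat`, stmt-ABC-20503): THE RECORD SUPPLY of the saturated odd-`p` frame
# from the record's budget (p1) and ONE headline inequality

`Summits/ABC/StewartYu/PadicG3SatNRecord.lean` — cell `abc-stewartyu` (seat p2-g7, line lead of `sat-odd`; record owner p1 g11).
Proofs only; no definition, no named fact.  The assembly of the package `hR` of `G3Setup.recordSupplyOddSatRD_of_package'`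
(`PadicG3SatNPackB`): the record is `parOddN` on the budget letter `W̃ = W + log N + log n! + 4 log n` (`exists_parOddN_static`,
eleven conjuncts), the smallness order is `U := E·log p` from the HEADLINE `2·(8·2ⁿ·Zp + CondFloorN n) ≤ c_h^n·(p/log p)·Ω·W⁺`
(`expLine_satN`, `4·c_h ≤ c`), and the four budget inequalities are p1's `PadicG3ParN.hKfar_N / hKlam_N / hHfar_N / hHlam_N`
(`PadicG3ParNBudgetC`, every `m`), whose START-order letter `(69/4)(n+1)LgV + 2(n+1)(ŜN − ŜG)` dominates the slim package's
`(69/4)(n+1)LgV` (`ŜG ≤ ŜN`), so they imply the package's lines by monotonicity.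
* `G3Setup.recordSupplyOddSatRD_of_headline` — `RecordSupplyOddSatRD (c^·) p n` (`n ≥ 2`, `p` odd, `c ≥ 256`, `4·c_h ≤ c`) from the
  headline at constant `c_h` stated for every `N`-record.

References: Yu. V. Nesterenko, LNM 1819 (2003) Prop 4.1, §4.2–4.3, §5 (shape only); K. Yu, Acta Math. 211 (2013) §7.
-/

noncomputable section

open Finset Real Matrix
open Literature.NumberTheory.Transcendental
open Summit.ABC.StewartYu.GenThreeFrameSpecOdd (RecordOdd)

namespace Summit.ABC.StewartYu

namespace G3Setup

/-! ### Monotonicity of the START-order letter (the slim package's `T₀ʳ·Y` against the budget's `(T₀ʳ + Δ)·Y`, `Δ, Y ≥ 0`) -/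

/-- k-step far line: dropping `Δ·Y ≥ 0` from the third summand keeps `<`. [folklore] -/
theorem bridge_kfar {L a b T D Y c d e f g Z : ℝ} (hD : 0 ≤ D) (hY : 0 ≤ Y)
    (h : L + (a + b + 2 * ((T + D) * Y) + c + d + e + f + g) < Z) :
    L + (a + b + 2 * (T * Y) + c + d + e + f + g) < Z := by
  nlinarith [mul_nonneg hD hY]

/-- k-step `U`-line: the same with the conditioning allowance in front. [folklore] -/
theorem bridge_klam {L A a b T D Y c d e f g Z : ℝ} (hD : 0 ≤ D) (hY : 0 ≤ Y)
    (h : L + A + (a + b + 2 * ((T + D) * Y) + c + d + e + f + g) < Z) :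
    L + A + (a + b + 2 * (T * Y) + c + d + e + f + g) < Z := by
  nlinarith [mul_nonneg hD hY]

/-- half-step far line: dropping `M·Δ·Y ≥ 0` (`M = 2^{n+1}`) keeps `<`. [folklore] -/
theorem bridge_hfar {L M a b T D Y c d e f g Z : ℝ} (hM : 0 ≤ M) (hD : 0 ≤ D) (hY : 0 ≤ Y)
    (h : L + M * (a + b + (T + D) * Y + c + d + e + f + g) < Z) :
    L + M * (a + b + T * Y + c + d + e + f + g) < Z := by
  nlinarith [mul_nonneg hM (mul_nonneg hD hY)]

/-- half-step `U`-line: the same with the conditioning allowance in front. [folklore] -/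
theorem bridge_hlam {L A M a b T D Y c d e f g Z : ℝ} (hM : 0 ≤ M) (hD : 0 ≤ D) (hY : 0 ≤ Y)
    (h : L + A + M * (a + b + (T + D) * Y + c + d + e + f + g) < Z) :
    L + A + M * (a + b + T * Y + c + d + e + f + g) < Z := by
  nlinarith [mul_nonneg hM (mul_nonneg hD hY)]

variable {p : ℕ} [Fact p.Prime]

set_option maxHeartbeats 400000 in
/-- **THE RECORD SUPPLY OF THE SATURATED ODD-`p` FRAME FROM ONE HEADLINE.**  If every `N`-record `P` at rank `n` with `θ₀ = ½`,
`N_q = K`, `1 ≤ Aⱼ`, `Amax ≤ 2ⁿΩ`, `K₀ = p − 1` satisfies the headline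
`2·(8·2ⁿ·Zp + CondFloorN n) ≤ c_h^n·(p/log p)·Ω·W⁺`, then `RecordSupplyOddSatRD (c^·) p n` for every `c ≥ max(256, 4·c_h)`
(`n ≥ 2`, `p` odd): record `parOddN` on `W̃`, order `U := ⌈B/log p⌉·log p`, budget lines `hKfar_N/hKlam_N/hHfar_N/hHlam_N`.
[cite: Nesterenko2003, Prop 4.1, §5; shape only] -/
theorem recordSupplyOddSatRD_of_headline {n : ℕ} (hn2 : 2 ≤ n) (hp2 : p ≠ 2) {c ch : ℝ} (hc : 256 ≤ c)
    (hch : 0 ≤ ch) (hc4 : 4 * ch ≤ c)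
    (hhead : ∀ P : PadicG3ParN n, P.θ₀ = 1 / 2 → P.Nq = P.K → (∀ j, 1 ≤ P.A j) → P.Amax ≤ 2 ^ n * P.Ω →
      (P.K₀ : ℝ) = P.p - 1 →
      2 * (8 * 2 ^ n * P.Zp + P.CondFloorN n) ≤ ch ^ n * ((P.p : ℝ) / Real.log P.p) * P.Ω * P.Wp) :
    RecordSupplyOddSatRD (fun m => c ^ m) p n := by
  refine recordSupplyOddSatRD_of_package' hn2 hp2 hc ?_
  intro S F V Vmax W hSn hαv hθv hV hV1 hVm hWbo hW1 hneg hNV hUcol hCb hθV hdet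
  subst hSn
  have hprime : p.Prime := Fact.out
  have hpR : (0 : ℝ) < p := by exact_mod_cast hprime.pos
  have hn1 : 1 ≤ S.n := by omega
  -- the record on the budget letter `W̃` (eleven static conjuncts)
  obtain ⟨P, hPp, hK₀, hgK, hθ, hNq, hK2, hPN, hPA, hPW, hAmaxV, hAmaxΩ, -, hK₀ge, hNCW, hWbW, hrec⟩ :=
    S.exists_parOddN_static hn1 F V Vmax W hV1 hVm hW1 hNV
  have hθle : (1 / 2 : ℝ) ≤ P.θ₀ := by rw [hθ]
  have hA1 : ∀ j, 1 ≤ P.A j := fun j => by rw [hPA]; exact hV1 j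
  have hNCW' : Real.log P.N + Real.log (S.n.factorial : ℝ) + 3 * Real.log S.n ≤ P.W := by rw [hPN]; exact hNCW
  -- the directions `b̃ = bo ᵥ* C`: `log max(3,|b̃ₖ|) ≤ log(n·(n!·N)) + W ≤ P.W`
  have hM1 : 1 ≤ S.n.factorial * F.N :=
    Nat.one_le_iff_ne_zero.mpr (Nat.mul_ne_zero S.n.factorial_pos.ne' (by have := F.hN; omega))
  have hbW : ∀ k, Real.log (max 3 (|S.b k| : ℝ)) ≤ P.W := by
    intro k
    have h := log_max_three_vecMul_le hn1 F.bo F.C hM1 hCb hWbo k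
    rw [← F.hb] at h
    exact h.trans hWbW
  -- the smallness order `U := E·log p` from the headline
  have hZ := P.Zp_facts.1
  obtain ⟨_, hκ0⟩ := P.kappa_le_one
  have hCF0 : 0 ≤ P.CondFloorN S.n := by
    unfold PadicG3ParN.CondFloorN
    have hg := P.one_le_g
    have : (0 : ℝ) ≤ P.XV := by positivity
    have : (0 : ℝ) ≤ 2 ^ (S.n + 1) * 2 ^ P.SdN * P.g * P.XV := by positivity
    exact mul_nonneg this hκ0
  have hB : P.Zp ≤ 8 * 2 ^ S.n * P.Zp + P.CondFloorN S.n := by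
    have h2 : (1 : ℝ) ≤ 2 ^ S.n := one_le_pow₀ (by norm_num)
    nlinarith
  have hK₀R : (P.K₀ : ℝ) = P.p - 1 := by
    rw [hK₀, hPp, Nat.cast_sub hprime.one_lt.le]; push_cast; ring
  obtain ⟨E, _, hΛE, hBE, _⟩ := S.expLine_satN F P V Vmax W hV1 hVm hW1 hNV hneg hPp hPA hAmaxV hθle hPW.le hbW hch hc4
    (hhead P hθ hNq hA1 hAmaxΩ hK₀R) hB
  set U : ℝ := (E : ℝ) * Real.log p with hUdef
  have hΛU : ‖S.Λ / (S.b S.j₀ : ℚ_[p])‖ ≤ Real.exp (-U) := by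
    refine hΛE.trans (le_of_eq ?_)
    rw [hUdef, Real.exp_neg, Real.exp_nat_mul, Real.exp_log hpR]
  have hU : 8 * 2 ^ S.n * P.Zp + P.CondFloorN S.n ≤ U := hBE
  -- monotonicity of the START-order letter: `(69/4)(n+1)LgV ≤ (69/4)(n+1)LgV + 2(n+1)(ŜN − ŜG)` against a nonnegative cost
  have hd : (0 : ℝ) ≤ (P.SdN : ℝ) - P.SdG := by
    have := P.SdG_le_SdN hNq
    have : (P.SdG : ℝ) ≤ P.SdN := by exact_mod_cast this
    linarith
  have hY : 0 ≤ (P.SdN : ℝ) * Real.log 2 + 23 / 20 * P.HV + (P.HV + P.W) := by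
    have hl2 : 0 < Real.log 2 := Real.log_pos one_lt_two
    have hH : (0 : ℝ) ≤ P.HV := by positivity
    have hW : (1 : ℝ) ≤ P.W := P.hW
    positivity
  have hD : (0 : ℝ) ≤ 2 * (S.n + 1) * ((P.SdN : ℝ) - P.SdG) := by positivity
  have h2n : (0 : ℝ) ≤ 2 ^ (S.n + 1) := by positivity
  refine ⟨P, U, hPp, hK₀, hgK, hθ, hNq, hK2, hPN, hPA, hNCW, hWbW, hΛU, ?_, ?_, ?_, ?_, hrec c hc⟩
  · intro ν hν
    have h := P.hKfar_N hθle hNq hK₀ge hgK hn2 hNCW' ν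
    rw [hPN] at h
    exact bridge_kfar hD hY h
  · intro lev ν hlev hν
    have h := P.hKlam_N hθle hNq hK₀ge hgK hn2 hNCW' hU hlev hν
    rw [hPN] at h
    exact bridge_klam hD hY h
  · have h := P.hHfar_N hθle hNq hK₀ge hgK hn2 hNCW'
    rw [hPN] at h
    exact bridge_hfar h2n hD hY h
  · intro lev hlev
    have h := P.hHlam_N hθle hNq hK₀ge hgK hn2 hNCW' hU hlev
    rw [hPN] at h
    exact bridge_hlam h2n hD hY h

end G3Setup

end Summit.ABC.StewartYu

end
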